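import Summits.QuantumFields.BalabanUV.Beta.GAN24.SaddlePointBound

/-!
# `BalabanUV.Beta.GAN24.SaddlePointBoundInverse` — leaf **P1-L10a**, PART 2: bounds on the INVERSE of the saddle-point matrix
# `K = Matrix.fromBlocks H C B 0` (binder row G-an2-4 / (CONV-C), road P1-fibre; consumer leaves P1-L09 / P1-L10)

NOT IN PRINT; OUR PROOF (of a textbook statement).  HONEST FRAMING (cell contract, verbatim): «discharging `BetaPertH` makes Bałaban's UV
stability UNCONDITIONAL — a real constructive-QFT result; it is NOT the continuum limit and NOT the Clay problem.»  HONEST DEPENDENCY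
(verbatim): «continuum YM on T⁴ ⇐ BetaPertH ∧ nine spine estimates (0/9 proved); BetaPertH ⇐ (D1) ∧ (D4) ∧ CAP+tail; G-an2-4 gates asym,
D1 and NE2/3/4.»  [folklore] finite-dimensional linear algebra over an `RCLike` field `𝕜`; no cited fact, no `def`, no wall binder, nothing
of (CONV-C)'s K-slot discharged.  NOT summit progress.

## What is proved (hypotheses = those of `SaddlePointBound.matrix_apriori`, constants explicit in `γ, β₁, β₂, η` only)
* `inv_mulVec_bound` — for every right-hand side `x : n ⊕ m → 𝕜` the solution `y = K⁻¹ x` obeys the two Brezzi bounds: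
  `‖y_n‖ ≤ γ⁻¹‖x_n‖ + β₁⁻¹(1 + η/γ)‖x_m‖`, `‖y_m‖ ≤ β₂⁻¹(1 + η/γ)‖x_n‖ + β₂⁻¹β₁⁻¹η(1 + η/γ)‖x_m‖` (Euclidean norms of the
  `Sum.inl` / `Sum.inr` parts);
* `inv_entry_bound` — ENTRYWISE: `‖K⁻¹ (inl i) (inl j)‖ ≤ γ⁻¹`, `‖K⁻¹ (inl i) (inr l)‖ ≤ β₁⁻¹(1 + η/γ)`, `‖K⁻¹ (inr k) (inl j)‖ ≤ β₂⁻¹(1 + η/γ)`,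
  `‖K⁻¹ (inr k) (inr l)‖ ≤ β₂⁻¹β₁⁻¹η(1 + η/γ)` (no dimension factors: an entry is a coordinate of a column, bounded by its Euclidean norm);
* `_conjTranspose` versions for the classical case `C = Bᴴ` (coercivity of `re ⟪w, H w⟫` on `ker B` + LBB), the statement of the row.
-/

open scoped InnerProductSpace
open RCLike Matrix WithLp

namespace Summit.QuantumFields.BalabanUV.Beta.GAN24.SaddlePointBoundInverse

open SaddlePointBound

variable {𝕜 : Type*} [RCLike 𝕜]
variable {n m : Type*} [Fintype n] [DecidableEq n] [Fintype m] [DecidableEq m]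

/-- [folklore] **Bounds for the inverse, block form.**  With `K = fromBlocks H C B 0` (invertible by `isUnit_fromBlocks`), every solution
`y = K⁻¹ x` satisfies the Brezzi bounds for its `n`-part and its `m`-part in terms of the parts of `x`. -/
theorem inv_mulVec_bound {H : Matrix n n 𝕜} {B : Matrix m n 𝕜} {C : Matrix n m 𝕜} {γ β₁ β₂ η : ℝ}
    (hγ : 0 < γ) (hβ₁ : 0 < β₁) (hβ₂ : 0 < β₂) (hη : 0 ≤ η)
    (hB : ∀ q : EuclideanSpace 𝕜 m, β₁ * ‖q‖ ≤ ‖toEuclideanLin Bᴴ q‖)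
    (hC : ∀ q : EuclideanSpace 𝕜 m, β₂ * ‖q‖ ≤ ‖toEuclideanLin C q‖)
    (hHC : ∀ w : EuclideanSpace 𝕜 n, toEuclideanLin B w = 0 → ∃ z : EuclideanSpace 𝕜 n,
      toEuclideanLin Cᴴ z = 0 ∧ ‖z‖ ≤ ‖w‖ ∧ γ * ‖w‖ ^ 2 ≤ re ⟪z, toEuclideanLin H w⟫_𝕜)
    (hH : ∀ v : EuclideanSpace 𝕜 n, ‖toEuclideanLin H v‖ ≤ η * ‖v‖) (x : n ⊕ m → 𝕜) :
    ‖(toLp 2 (((Matrix.fromBlocks H C B 0)⁻¹ *ᵥ x) ∘ Sum.inl) : EuclideanSpace 𝕜 n)‖ ≤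
        γ⁻¹ * ‖(toLp 2 (x ∘ Sum.inl) : EuclideanSpace 𝕜 n)‖ +
          β₁⁻¹ * (1 + η / γ) * ‖(toLp 2 (x ∘ Sum.inr) : EuclideanSpace 𝕜 m)‖ ∧
      ‖(toLp 2 (((Matrix.fromBlocks H C B 0)⁻¹ *ᵥ x) ∘ Sum.inr) : EuclideanSpace 𝕜 m)‖ ≤
        β₂⁻¹ * (1 + η / γ) * ‖(toLp 2 (x ∘ Sum.inl) : EuclideanSpace 𝕜 n)‖ +
          β₂⁻¹ * β₁⁻¹ * η * (1 + η / γ) * ‖(toLp 2 (x ∘ Sum.inr) : EuclideanSpace 𝕜 m)‖ := by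
  set K := Matrix.fromBlocks H C B 0 with hKdef
  have hK : IsUnit K.det :=
    (Matrix.isUnit_iff_isUnit_det K).mp (isUnit_fromBlocks hγ hβ₁ hβ₂ hη hB hC hHC hH)
  set y := K⁻¹ *ᵥ x with hy
  have hKy : K *ᵥ y = x := by rw [hy, Matrix.mulVec_mulVec, Matrix.mul_nonsing_inv K hK, Matrix.one_mulVec]
  have hsplit : Sum.elim (H *ᵥ (y ∘ Sum.inl) + C *ᵥ (y ∘ Sum.inr)) (B *ᵥ (y ∘ Sum.inl)) = x := by
    rw [← fromBlocks_mulVec_sumElim, Sum.elim_comp_inl_inr, ← hKdef, hKy]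
  have h1 : H *ᵥ (y ∘ Sum.inl) + C *ᵥ (y ∘ Sum.inr) = x ∘ Sum.inl := by
    have := congr_arg (fun f => f ∘ Sum.inl) hsplit; simpa using this
  have h2 : B *ᵥ (y ∘ Sum.inl) = x ∘ Sum.inr := by
    have := congr_arg (fun f => f ∘ Sum.inr) hsplit; simpa using this
  have key := matrix_apriori hγ hβ₁ hβ₂ hη hB hC hHC hH (y ∘ Sum.inl) (y ∘ Sum.inr)
  rw [h1, h2] at key
  exact key

omit [DecidableEq n] [Fintype m] [DecidableEq m] in
/-- [folklore] A coordinate is bounded by the Euclidean norm. -/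
theorem norm_apply_le_norm_toLp (a : n → 𝕜) (i : n) : ‖a i‖ ≤ ‖(toLp 2 a : EuclideanSpace 𝕜 n)‖ := by
  have := PiLp.norm_apply_le (toLp 2 a : EuclideanSpace 𝕜 n) i
  simpa using this

/-- [folklore] **Entrywise bounds for the inverse** of `K = fromBlocks H C B 0` (the four blocks of `K⁻¹`; no dimension factors). -/
theorem inv_entry_bound {H : Matrix n n 𝕜} {B : Matrix m n 𝕜} {C : Matrix n m 𝕜} {γ β₁ β₂ η : ℝ}
    (hγ : 0 < γ) (hβ₁ : 0 < β₁) (hβ₂ : 0 < β₂) (hη : 0 ≤ η)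
    (hB : ∀ q : EuclideanSpace 𝕜 m, β₁ * ‖q‖ ≤ ‖toEuclideanLin Bᴴ q‖)
    (hC : ∀ q : EuclideanSpace 𝕜 m, β₂ * ‖q‖ ≤ ‖toEuclideanLin C q‖)
    (hHC : ∀ w : EuclideanSpace 𝕜 n, toEuclideanLin B w = 0 → ∃ z : EuclideanSpace 𝕜 n,
      toEuclideanLin Cᴴ z = 0 ∧ ‖z‖ ≤ ‖w‖ ∧ γ * ‖w‖ ^ 2 ≤ re ⟪z, toEuclideanLin H w⟫_𝕜)
    (hH : ∀ v : EuclideanSpace 𝕜 n, ‖toEuclideanLin H v‖ ≤ η * ‖v‖) :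
    (∀ i j : n, ‖(Matrix.fromBlocks H C B 0)⁻¹ (Sum.inl i) (Sum.inl j)‖ ≤ γ⁻¹) ∧
    (∀ (i : n) (l : m), ‖(Matrix.fromBlocks H C B 0)⁻¹ (Sum.inl i) (Sum.inr l)‖ ≤ β₁⁻¹ * (1 + η / γ)) ∧
    (∀ (k : m) (j : n), ‖(Matrix.fromBlocks H C B 0)⁻¹ (Sum.inr k) (Sum.inl j)‖ ≤ β₂⁻¹ * (1 + η / γ)) ∧
    (∀ k l : m, ‖(Matrix.fromBlocks H C B 0)⁻¹ (Sum.inr k) (Sum.inr l)‖ ≤ β₂⁻¹ * β₁⁻¹ * η * (1 + η / γ)) := by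
  set K := Matrix.fromBlocks H C B 0 with hKdef
  -- column `c` of `K⁻¹` is `K⁻¹ *ᵥ Pi.single c 1`
  have hcol : ∀ (c r : n ⊕ m), K⁻¹ r c = (K⁻¹ *ᵥ Pi.single c 1) r := fun c r => by
    rw [Matrix.mulVec_single_one]; rfl
  have est := fun c : n ⊕ m => inv_mulVec_bound hγ hβ₁ hβ₂ hη hB hC hHC hH (Pi.single c (1 : 𝕜))
  -- the parts of the unit vectors
  have s1 : ∀ j : n, (Pi.single (Sum.inl j) (1 : 𝕜) : n ⊕ m → 𝕜) ∘ Sum.inl = Pi.single j 1 := fun j => by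
    funext i; simp [Pi.single_apply]
  have s2 : ∀ j : n, (Pi.single (Sum.inl j) (1 : 𝕜) : n ⊕ m → 𝕜) ∘ Sum.inr = 0 := fun j => by
    funext i; simp
  have s3 : ∀ l : m, (Pi.single (Sum.inr l) (1 : 𝕜) : n ⊕ m → 𝕜) ∘ Sum.inl = 0 := fun l => by
    funext i; simp
  have s4 : ∀ l : m, (Pi.single (Sum.inr l) (1 : 𝕜) : n ⊕ m → 𝕜) ∘ Sum.inr = Pi.single l 1 := fun l => by
    funext i; simp [Pi.single_apply]
  have n1 : ∀ j : n, ‖(toLp 2 (Pi.single j (1 : 𝕜)) : EuclideanSpace 𝕜 n)‖ = 1 := fun j => by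
    rw [PiLp.toLp_single, PiLp.norm_single, norm_one]
  have n2 : ∀ l : m, ‖(toLp 2 (Pi.single l (1 : 𝕜)) : EuclideanSpace 𝕜 m)‖ = 1 := fun l => by
    rw [PiLp.toLp_single, PiLp.norm_single, norm_one]
  refine ⟨fun i j => ?_, fun i l => ?_, fun k j => ?_, fun k l => ?_⟩
  · have h := (est (Sum.inl j)).1
    rw [s1, s2, n1, WithLp.toLp_zero, norm_zero, mul_one, mul_zero, add_zero] at h
    rw [hcol]; exact (norm_apply_le_norm_toLp _ i).trans h
  · have h := (est (Sum.inr l)).1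
    rw [s3, s4, n2, WithLp.toLp_zero, norm_zero, mul_zero, zero_add, mul_one] at h
    rw [hcol]; exact (norm_apply_le_norm_toLp _ i).trans h
  · have h := (est (Sum.inl j)).2
    rw [s1, s2, n1, WithLp.toLp_zero, norm_zero, mul_one, mul_zero, add_zero] at h
    rw [hcol]; exact (norm_apply_le_norm_toLp _ k).trans h
  · have h := (est (Sum.inr l)).2
    rw [s3, s4, n2, WithLp.toLp_zero, norm_zero, mul_zero, zero_add, mul_one] at h
    rw [hcol]; exact (norm_apply_le_norm_toLp _ k).trans h

/-- [folklore] **Classical case `C = Bᴴ`, block form**: LBB `β‖q‖ ≤ ‖Bᴴ q‖`, coercivity `γ‖w‖² ≤ re ⟪w, H w⟫` on `ker B`, `‖H‖ ≤ η` ⟹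
the Brezzi bounds for both parts of `(fromBlocks H Bᴴ B 0)⁻¹ x`. -/
theorem inv_mulVec_bound_conjTranspose {H : Matrix n n 𝕜} {B : Matrix m n 𝕜} {γ β η : ℝ}
    (hγ : 0 < γ) (hβ : 0 < β) (hη : 0 ≤ η)
    (hB : ∀ q : EuclideanSpace 𝕜 m, β * ‖q‖ ≤ ‖toEuclideanLin Bᴴ q‖)
    (hcoer : ∀ w : EuclideanSpace 𝕜 n, toEuclideanLin B w = 0 → γ * ‖w‖ ^ 2 ≤ re ⟪w, toEuclideanLin H w⟫_𝕜)
    (hH : ∀ v : EuclideanSpace 𝕜 n, ‖toEuclideanLin H v‖ ≤ η * ‖v‖) (x : n ⊕ m → 𝕜) :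
    ‖(toLp 2 (((Matrix.fromBlocks H Bᴴ B 0)⁻¹ *ᵥ x) ∘ Sum.inl) : EuclideanSpace 𝕜 n)‖ ≤
        γ⁻¹ * ‖(toLp 2 (x ∘ Sum.inl) : EuclideanSpace 𝕜 n)‖ +
          β⁻¹ * (1 + η / γ) * ‖(toLp 2 (x ∘ Sum.inr) : EuclideanSpace 𝕜 m)‖ ∧
      ‖(toLp 2 (((Matrix.fromBlocks H Bᴴ B 0)⁻¹ *ᵥ x) ∘ Sum.inr) : EuclideanSpace 𝕜 m)‖ ≤
        β⁻¹ * (1 + η / γ) * ‖(toLp 2 (x ∘ Sum.inl) : EuclideanSpace 𝕜 n)‖ +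
          β⁻¹ * β⁻¹ * η * (1 + η / γ) * ‖(toLp 2 (x ∘ Sum.inr) : EuclideanSpace 𝕜 m)‖ :=
  inv_mulVec_bound hγ hβ hβ hη hB hB (matrix_test_vector_of_coercive hcoer) hH x

/-- [folklore] **Classical case `C = Bᴴ`, entrywise** (the statement of table row P1-L10a: "the four blocks of `K⁻¹` are bounded by explicit
constants in `(γ, β, ‖H‖)`"): `‖K⁻¹_{nn}‖ ≤ γ⁻¹`, `‖K⁻¹_{nm}‖, ‖K⁻¹_{mn}‖ ≤ β⁻¹(1 + η/γ)`, `‖K⁻¹_{mm}‖ ≤ β⁻²η(1 + η/γ)` entrywise. -/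
theorem inv_entry_bound_conjTranspose {H : Matrix n n 𝕜} {B : Matrix m n 𝕜} {γ β η : ℝ}
    (hγ : 0 < γ) (hβ : 0 < β) (hη : 0 ≤ η)
    (hB : ∀ q : EuclideanSpace 𝕜 m, β * ‖q‖ ≤ ‖toEuclideanLin Bᴴ q‖)
    (hcoer : ∀ w : EuclideanSpace 𝕜 n, toEuclideanLin B w = 0 → γ * ‖w‖ ^ 2 ≤ re ⟪w, toEuclideanLin H w⟫_𝕜)
    (hH : ∀ v : EuclideanSpace 𝕜 n, ‖toEuclideanLin H v‖ ≤ η * ‖v‖) :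
    (∀ i j : n, ‖(Matrix.fromBlocks H Bᴴ B 0)⁻¹ (Sum.inl i) (Sum.inl j)‖ ≤ γ⁻¹) ∧
    (∀ (i : n) (l : m), ‖(Matrix.fromBlocks H Bᴴ B 0)⁻¹ (Sum.inl i) (Sum.inr l)‖ ≤ β⁻¹ * (1 + η / γ)) ∧
    (∀ (k : m) (j : n), ‖(Matrix.fromBlocks H Bᴴ B 0)⁻¹ (Sum.inr k) (Sum.inl j)‖ ≤ β⁻¹ * (1 + η / γ)) ∧
    (∀ k l : m, ‖(Matrix.fromBlocks H Bᴴ B 0)⁻¹ (Sum.inr k) (Sum.inr l)‖ ≤ β⁻¹ * β⁻¹ * η * (1 + η / γ)) :=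
  inv_entry_bound hγ hβ hβ hη hB hB (matrix_test_vector_of_coercive hcoer) hH

end Summit.QuantumFields.BalabanUV.Beta.GAN24.SaddlePointBoundInverse
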